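import Mathlib

/-!
# Uniqueness for the linear complementarity problem with a positive-definite operator

Finite-dimensional kernel of the reduced pattern problem of the steady zeroth-law programme
(solo-blind paper §24.16(11)): the leaf intensity `q ≥ 0` of a band-filling columnar pattern solves
the LCP `q ≥ 0`, `Q q - b ≥ 0`, `q ⬝ (Q q - b) = 0`, where `b = σ - K₀` is the leafwise supercriticality
and `Q = ℓ₂ + 𝓛` the Landau operator.  If `Q` is positive definite (not necessarily symmetric) the LCP
has at most one solution.  This is the discrete statement; no analysis is involved.
-/

namespace Summit.AnomalousDissipation.AnomalousDissipation.Theorems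

open Matrix

/-- A solution of the linear complementarity problem `LCP(Q, b)`: `q ≥ 0`, `Q q ≥ b` componentwise,
and complementarity `q ⬝ᵥ (Q q - b) = 0`. -/
structure IsLCPSolution {ι : Type*} [Fintype ι] (Q : Matrix ι ι ℝ) (b q : ι → ℝ) : Prop where
  nonneg : ∀ i, 0 ≤ q i
  feasible : ∀ i, b i ≤ (Q *ᵥ q) i
  compl : q ⬝ᵥ (Q *ᵥ q - b) = 0

/-- Cross inequality: if `q₁ ≥ 0` and `Q q₂ ≥ b` then `q₁ ⬝ b ≤ q₁ ⬝ Q q₂`. -/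
lemma dotProduct_le_of_nonneg_of_le {ι : Type*} [Fintype ι] (q₁ w b : ι → ℝ)
    (h1 : ∀ i, 0 ≤ q₁ i) (h2 : ∀ i, b i ≤ w i) : q₁ ⬝ᵥ b ≤ q₁ ⬝ᵥ w := by
  unfold dotProduct
  exact Finset.sum_le_sum fun i _ => mul_le_mul_of_nonneg_left (h2 i) (h1 i)

/-- **LCP uniqueness.** For a positive-definite (not necessarily symmetric) matrix `Q`, the linear
complementarity problem `LCP(Q, b)` has at most one solution. -/
theorem lcp_unique_of_posDef {ι : Type*} [Fintype ι] (Q : Matrix ι ι ℝ) (b q₁ q₂ : ι → ℝ)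
    (hpos : ∀ v : ι → ℝ, v ≠ 0 → 0 < v ⬝ᵥ (Q *ᵥ v))
    (h₁ : IsLCPSolution Q b q₁) (h₂ : IsLCPSolution Q b q₂) : q₁ = q₂ := by
  by_contra hne
  have hv : q₁ - q₂ ≠ 0 := sub_ne_zero.mpr hne
  have key := hpos _ hv
  -- expand the quadratic form of the difference
  have hexp : (q₁ - q₂) ⬝ᵥ (Q *ᵥ (q₁ - q₂))
      = q₁ ⬝ᵥ (Q *ᵥ q₁) - q₁ ⬝ᵥ (Q *ᵥ q₂) - (q₂ ⬝ᵥ (Q *ᵥ q₁) - q₂ ⬝ᵥ (Q *ᵥ q₂)) := by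
    rw [Matrix.mulVec_sub, sub_dotProduct, dotProduct_sub, dotProduct_sub]
  -- complementarity gives the diagonal terms
  have hd₁ : q₁ ⬝ᵥ (Q *ᵥ q₁) = q₁ ⬝ᵥ b := by
    have := h₁.compl; rw [dotProduct_sub] at this; linarith
  have hd₂ : q₂ ⬝ᵥ (Q *ᵥ q₂) = q₂ ⬝ᵥ b := by
    have := h₂.compl; rw [dotProduct_sub] at this; linarith
  -- feasibility of the other solution bounds the cross terms from below
  have hc₁ : q₁ ⬝ᵥ b ≤ q₁ ⬝ᵥ (Q *ᵥ q₂) := dotProduct_le_of_nonneg_of_le q₁ _ b h₁.nonneg h₂.feasible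
  have hc₂ : q₂ ⬝ᵥ b ≤ q₂ ⬝ᵥ (Q *ᵥ q₁) := dotProduct_le_of_nonneg_of_le q₂ _ b h₂.nonneg h₁.feasible
  have : (q₁ - q₂) ⬝ᵥ (Q *ᵥ (q₁ - q₂)) ≤ 0 := by rw [hexp, hd₁, hd₂]; linarith
  exact absurd key (not_lt.mpr this)

/-- The complementary statement used by the programme: with `b = σ - K₀`, a positive-definite Landau
operator admits at most one nonnegative leaf-intensity profile (the pattern envelope is determined). -/
theorem pattern_envelope_unique {ι : Type*} [Fintype ι] (Landau : Matrix ι ι ℝ) (σ : ι → ℝ) (K₀ : ℝ)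
    (hpos : ∀ v : ι → ℝ, v ≠ 0 → 0 < v ⬝ᵥ (Landau *ᵥ v)) (q₁ q₂ : ι → ℝ)
    (h₁ : IsLCPSolution Landau (fun i => σ i - K₀) q₁) (h₂ : IsLCPSolution Landau (fun i => σ i - K₀) q₂) :
    q₁ = q₂ :=
  lcp_unique_of_posDef Landau _ q₁ q₂ hpos h₁ h₂

end Summit.AnomalousDissipation.AnomalousDissipation.Theorems
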